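import Mathlib
import Summits.Ventures.PercRepro2.SwOutAll
import Summits.Ventures.PercRepro2.SwOutLeaf

/-!
# THE MARK AT A LEAF, I: the cluster lemmas of a leaf edge and the colour swap with the leaf edge
kept red (blind cell PercRepro2, night-4 g27, 2026-08-28; proofs/NIGHT4-G27.md §12)

Let `x` be a LEAF at `p` (its only edge `e = xp`).  A leaf enters a cluster only through its edge
(`IsLeafAt.mem_cluster_leaf_iff`); recolouring the leaf edge changes no cluster away from the
leaf (`IsLeafAt.mem_cluster_of_agree_off_leaf`), hence the side `Q_x = {h ∉ H_l, x ∈ C_R(l),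
x ∉ C_B(l)}` is `{h ∉ H_l, e red, p ∈ C_R(l)}` (`IsLeafAt.mem_tgt_leaf_iff`), the red edge set of
`h` does not see the leaf edge while `p` is in no red cluster of `h` (`redEdges_eq_of_agree_off_leaf`)
and closing the leaf edge removes it from the red edge set and nothing else
(`redEdges_eq_sdiff_of_agree_off_leaf`); row 2′SW-ALL gives the rigid counting inequality on its
side (`card_le_of_swAll`); and THE COLOUR SWAP WITH `e` KEPT RED, `swapKeep e ζ = update (blue ζ)
e true`, is an involution of the part `B = {e red, h ∉ H_l, p ∈ C_R(l) ∩ C_B(l)}` of `Q_x`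
(`IsLeafAt.swapKeep_mem`) exchanging the red and the blue edge sets of `h`
(`IsLeafAt.redEdges_swapKeep`).  The theorem is `SwAllLeafMark`.
-/

namespace Summit.Ventures.PercRepro2

namespace LocRows

open Hull

variable {V : Type*} {E : Type*}

section Leaf

variable {ends : E → Sym2 V} {x p : V} {e : E} (hleaf : IsLeafAt ends x p e)
include hleaf

/-- The other end of an edge at the leaf is `p`. -/
lemma IsLeafAt.eq_of_ends {e' : E} {y : V} (h : ends e' = s(x, y)) : e' = e ∧ y = p := by
  have he' : e' = e := hleaf.only e' (by rw [h]; exact Sym2.mem_mk_left _ _)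
  subst he'
  rw [hleaf.ends₁, Sym2.eq_iff] at h
  rcases h with ⟨-, h2⟩ | ⟨-, h2⟩
  · exact ⟨rfl, h2.symm⟩
  · exact absurd h2.symm hleaf.up

/-- **A leaf enters a cluster only through its edge**: for a root `v ≠ x`, `x ∈ C(v)` iff the leaf
edge is open and `p ∈ C(v)`. -/
lemma IsLeafAt.mem_cluster_leaf_iff {ζ : Config E} {v : V} (hv : v ≠ x) :
    x ∈ cluster ends ζ v ↔ ζ e = true ∧ p ∈ cluster ends ζ v := by
  constructor
  · intro hx
    have key : x ∈ {y | Conn ends ζ v y ∧ (y ≠ x ∨ (ζ e = true ∧ p ∈ cluster ends ζ v))} := by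
      refine mem_of_conn_of_closed (ends := ends) (ω := ζ) ?_ ⟨conn_refl ends ζ v, Or.inl hv⟩ hx
      rintro y ⟨hy, hy'⟩ z hyz
      obtain ⟨hne, e', he', hends⟩ := openGraph_adj.1 hyz
      refine ⟨conn_trans hy (conn_of_openAdj ⟨e', he', hends⟩), ?_⟩
      by_cases hzx : z = x
      · subst hzx
        obtain ⟨he'e, hyp⟩ := hleaf.eq_of_ends (ends_swap hends)
        subst he'e
        rw [hyp] at hy
        exact Or.inr ⟨he', hy⟩
      · exact Or.inl hzx
    rcases key.2 with h | h
    · exact absurd rfl h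
    · exact h
  · rintro ⟨he, hp⟩
    exact mem_cluster_of_edge hp he (ends_swap hleaf.ends₁)

/-- **Recolouring the leaf edge changes no cluster away from the leaf**: two configurations
agreeing off `e` have the same clusters at every root `v ≠ x`, on every vertex `w ≠ x`. -/
lemma IsLeafAt.mem_cluster_of_agree_off_leaf {ζ ζ' : Config E} (hagree : ∀ e', e' ≠ e → ζ e' = ζ' e')
    {v w : V} (hv : v ≠ x) (hw : w ≠ x) (h : w ∈ cluster ends ζ v) : w ∈ cluster ends ζ' v := by
  have key : w ∈ {y | Conn ends ζ v y ∧ (y ≠ x → Conn ends ζ' v y) ∧ (y = x → Conn ends ζ' v p)} := by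
    refine mem_of_conn_of_closed (ends := ends) (ω := ζ) ?_
      ⟨conn_refl ends ζ v, fun _ => conn_refl ends ζ' v, fun h' => absurd h' hv⟩ h
    rintro y ⟨hy, hy1, hy2⟩ z hyz
    obtain ⟨hne, e', he', hends⟩ := openGraph_adj.1 hyz
    refine ⟨conn_trans hy (conn_of_openAdj ⟨e', he', hends⟩), ?_, ?_⟩
    · intro hzx
      by_cases hee : e' = e
      · -- the leaf edge: `z ≠ x` forces `y = x` and `z = p`, connected in `ζ'` by `hy2`
        subst hee
        rw [hleaf.ends₁, Sym2.eq_iff] at hends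
        rcases hends with ⟨h1, h2⟩ | ⟨h1, -⟩
        · rw [← h2]
          exact hy2 h1.symm
        · exact absurd h1.symm hzx
      · have hyx : y ≠ x := by
          intro hyx
          subst hyx
          exact hee (hleaf.only e' (by rw [hends]; exact Sym2.mem_mk_left _ _))
        have he'' : ζ' e' = true := by rw [← hagree e' hee]; exact he'
        exact conn_trans (hy1 hyx) (conn_of_openAdj ⟨e', he'', hends⟩)
    · intro hzx
      subst hzx
      obtain ⟨-, hyp⟩ := hleaf.eq_of_ends (ends_swap hends)
      rw [hyp] at hy1
      exact hy1 fun h' => hleaf.up h'.symm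
  exact key.2.1 hw

/-- The leaf edge is inside no cluster not containing `p`. -/
lemma IsLeafAt.leaf_edge_notMem_within {ζ : Config E} {v : V} (hp : p ∉ cluster ends ζ v) :
    e ∉ within ends (cluster ends ζ v) := by
  rintro ⟨a, ha, b, hb, hab⟩
  rw [hleaf.ends₁, Sym2.eq_iff] at hab
  rcases hab with ⟨-, h2⟩ | ⟨-, h2⟩
  · exact hp (h2 ▸ hb)
  · exact hp (h2 ▸ ha)

/-- An edge other than the leaf edge lies inside a cluster of `v ≠ x` in `ζ` iff in `ζ'`, when
the two agree off the leaf edge. -/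
lemma IsLeafAt.mem_within_iff_of_agree_off_leaf {ζ ζ' : Config E} (hagree : ∀ e', e' ≠ e → ζ e' = ζ' e')
    {v : V} (hv : v ≠ x) {e' : E} (hee : e' ≠ e) :
    e' ∈ within ends (cluster ends ζ v) ↔ e' ∈ within ends (cluster ends ζ' v) := by
  have hagree' : ∀ e'', e'' ≠ e → ζ' e'' = ζ e'' := fun e'' h => (hagree e'' h).symm
  have hnx : ∀ y, y ∈ ends e' → y ≠ x := by
    intro y hy hyx
    subst hyx
    exact hee (hleaf.only e' hy)
  constructor
  · rintro ⟨a, ha, b, hb, hab⟩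
    refine ⟨a, ?_, b, ?_, hab⟩
    · exact hleaf.mem_cluster_of_agree_off_leaf hagree hv (hnx a (by rw [hab]; exact Sym2.mem_mk_left _ _)) ha
    · exact hleaf.mem_cluster_of_agree_off_leaf hagree hv (hnx b (by rw [hab]; exact Sym2.mem_mk_right _ _)) hb
  · rintro ⟨a, ha, b, hb, hab⟩
    refine ⟨a, ?_, b, ?_, hab⟩
    · exact hleaf.mem_cluster_of_agree_off_leaf hagree' hv (hnx a (by rw [hab]; exact Sym2.mem_mk_left _ _)) ha
    · exact hleaf.mem_cluster_of_agree_off_leaf hagree' hv (hnx b (by rw [hab]; exact Sym2.mem_mk_right _ _)) hb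

end Leaf

section Main

variable [Fintype E] [DecidableEq E]

open scoped Classical

variable {ends : E → Sym2 V} {x p : V} {e : E} (hleaf : IsLeafAt ends x p e) {l h : V}
  (hxl : x ≠ l) (hxh : x ≠ h)
include hleaf

omit hleaf in
/-- The side `Q` unpacked (a local copy of the unfolding). -/
lemma mem_tgt_iff {ζ : Config E} {o : V} :
    ζ ∈ tgtU ends l h {S : Set V | o ∈ S} ↔
      h ∉ hull ends ζ l ∧ o ∈ cluster ends ζ l ∧ o ∉ cluster ends (blue ζ) l := by
  simp only [tgtU, Finset.mem_filter, Finset.mem_univ, true_and, Set.mem_setOf_eq]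

include hxl in
/-- **The side of the leaf**: `Q_x = {h ∉ H_l, e red, p ∈ C_R(l)}`. -/
lemma IsLeafAt.mem_tgt_leaf_iff {ζ : Config E} :
    ζ ∈ tgtU ends l h {S : Set V | x ∈ S} ↔
      h ∉ hull ends ζ l ∧ ζ e = true ∧ p ∈ cluster ends ζ l := by
  rw [mem_tgt_iff]
  have hlx : l ≠ x := hxl.symm
  constructor
  · rintro ⟨h1, h2, -⟩
    exact ⟨h1, (hleaf.mem_cluster_leaf_iff hlx).1 h2⟩
  · rintro ⟨h1, h2, h3⟩
    refine ⟨h1, (hleaf.mem_cluster_leaf_iff hlx).2 ⟨h2, h3⟩, fun hx => ?_⟩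
    have := ((hleaf.mem_cluster_leaf_iff hlx).1 hx).1
    rw [blue_eq_true_iff, h2] at this
    exact Bool.noConfusion this

omit hleaf [Fintype E] [DecidableEq E] in
/-- A vertex of a cluster of `l` lies in no cluster of `h` when `h ∉ H_l` (red version). -/
lemma notMem_cluster_h_of_mem_cluster_l {ζ : Config E} {v : V} (hh : h ∉ hull ends ζ l)
    (hv : v ∈ cluster ends ζ l) : v ∉ cluster ends ζ h :=
  fun hv' => hh (Or.inl (conn_trans hv (conn_symm hv')))

omit hleaf [Fintype E] [DecidableEq E] in
/-- A vertex of the blue cluster of `l` lies in no blue cluster of `h` when `h ∉ H_l`. -/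
lemma notMem_cluster_blue_h_of_mem_cluster_blue_l {ζ : Config E} {v : V}
    (hh : h ∉ hull ends ζ l) (hv : v ∈ cluster ends (blue ζ) l) : v ∉ cluster ends (blue ζ) h :=
  fun hv' => hh (Or.inr (conn_trans hv (conn_symm hv')))

omit hleaf [Fintype E] in
/-- An update agrees with the original off the updated edge. -/
lemma update_agree_off (ζ : Config E) (b : Bool) : ∀ e', e' ≠ e → ζ e' = Function.update ζ e b e' :=
  fun _ hee => (Function.update_of_ne hee b ζ).symm

omit [Fintype E] in
include hxh in
/-- **The red edge set of `h` does not see the leaf edge**: for two configurations agreeing off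
`e` with `p` in neither red cluster of `h`, the red edge sets of `h` coincide. -/
lemma IsLeafAt.redEdges_eq_of_agree_off_leaf {ζ ζ' : Config E} (hagree : ∀ e', e' ≠ e → ζ e' = ζ' e')
    (hp : p ∉ cluster ends ζ h) (hp' : p ∉ cluster ends ζ' h) :
    redEdges ends ζ h = redEdges ends ζ' h := by
  ext e'
  by_cases hee : e' = e
  · subst hee
    simp only [mem_redEdges]
    constructor
    · rintro ⟨-, h2⟩; exact absurd h2 (hleaf.leaf_edge_notMem_within hp)
    · rintro ⟨-, h2⟩; exact absurd h2 (hleaf.leaf_edge_notMem_within hp')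
  · simp only [mem_redEdges]
    rw [hagree e' hee, hleaf.mem_within_iff_of_agree_off_leaf hagree hxh.symm hee]

end Main

section Counting

variable [Fintype E] [DecidableEq E]

open scoped Classical

variable {ends : E → Sym2 V} {x p : V} {e : E} (hleaf : IsLeafAt ends x p e) {l h : V}
  (hxl : x ≠ l) (hxh : x ≠ h)
include hleaf hxh

omit [Fintype E] in
/-- **Closing the leaf edge removes it from the red edge set of `h` and nothing else.** -/
lemma IsLeafAt.redEdges_eq_sdiff_of_agree_off_leaf {ζ ζ' : Config E}
    (hagree : ∀ e', e' ≠ e → ζ e' = ζ' e') (hζ' : ζ' e = false) :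
    redEdges ends ζ' h = redEdges ends ζ h \ {e} := by
  ext e'
  by_cases hee : e' = e
  · subst hee
    simp only [mem_redEdges, hζ', Set.mem_sdiff, Set.mem_singleton_iff, not_true_eq_false,
      and_false, Bool.false_eq_true, false_and]
  · simp only [mem_redEdges, Set.mem_sdiff, Set.mem_singleton_iff, hee, not_false_eq_true, and_true]
    rw [hagree e' hee, hleaf.mem_within_iff_of_agree_off_leaf hagree hxh.symm hee]

omit hleaf hxh in
/-- **Row 2′SW-ALL gives the rigid counting inequality** on its side, for every up-set. -/
lemma card_le_of_swAll {o : V} (hs : SwAll ends l h o) (𝓔 : Set (Set E)) (h𝓔 : IsUpperSet 𝓔) :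
    ((tgtU ends l h {S : Set V | o ∈ S}).filter fun ζ => redEdges ends ζ h ∈ 𝓔).card ≤
      ((tgtU ends l h {S : Set V | o ∈ S}).filter fun ζ => blueEdges ends ζ h ∈ 𝓔).card := by
  obtain ⟨f, hf, hmem⟩ := hs
  refine Finset.card_le_card_of_injOn (fun ζ => if hζ : ζ ∈ tgtU ends l h {S : Set V | o ∈ S}
    then f ⟨ζ, hζ⟩ else ζ) ?_ ?_
  · intro ζ hζ
    rw [Finset.mem_coe, Finset.mem_filter] at hζ ⊢
    obtain ⟨hQ, hR⟩ := hζ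
    simp only [hQ, dite_true]
    refine ⟨(hmem ⟨ζ, hQ⟩).1, h𝓔 ?_ hR⟩
    intro e' he'
    obtain ⟨hred, hin⟩ := he'
    have hsub := cluster_subset_of_red_flipped ends (hmem ⟨ζ, hQ⟩).2
    refine ⟨blue_eq_true_iff.2 ((hmem ⟨ζ, hQ⟩).2 e' hin hred), ?_⟩
    obtain ⟨a, ha, b, hb, hab⟩ := hin
    exact ⟨a, hsub ha, b, hsub hb, hab⟩
  · intro ζ hζ ζ' hζ' heq
    rw [Finset.mem_coe, Finset.mem_filter] at hζ hζ'
    simp only [hζ.1, hζ'.1, dite_true] at heq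
    exact congrArg Subtype.val (hf heq)

/-- The colour swap with the leaf edge kept red. -/
noncomputable def swapKeep (e : E) (ζ : Config E) : Config E := Function.update (blue ζ) e true

omit hleaf hxh [Fintype E] in
/-- The swap agrees with the colour swap off the leaf edge. -/
lemma swapKeep_agree (ζ : Config E) : ∀ e', e' ≠ e → swapKeep e ζ e' = blue ζ e' :=
  fun _ hee => Function.update_of_ne hee _ _

omit hleaf hxh [Fintype E] in
/-- The swap keeps the leaf edge red. -/
lemma swapKeep_self (ζ : Config E) : swapKeep e ζ e = true := by simp [swapKeep]

omit hleaf hxh [Fintype E] in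
/-- The colour swap of the swapped configuration closes the leaf edge. -/
lemma blue_swapKeep (ζ : Config E) : blue (swapKeep e ζ) = Function.update ζ e false := by
  rw [swapKeep, blue_update, blue_blue]; rfl

omit hleaf hxh [Fintype E] in
/-- The swap is an involution on the configurations with the leaf edge red. -/
lemma swapKeep_swapKeep {ζ : Config E} (hζ : ζ e = true) : swapKeep e (swapKeep e ζ) = ζ := by
  rw [swapKeep, blue_swapKeep]
  funext e'
  by_cases hee : e' = e
  · subst hee; simp [hζ]
  · simp [Function.update_of_ne hee]

include hxl in
/-- **The swap keeps the part `B` of the side of the leaf**: for `ζ ∈ Q_x` with `p ∈ C_B(l)`, the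
swapped configuration is again in `Q_x` with `p ∈ C_B(l)`. -/
lemma IsLeafAt.swapKeep_mem {ζ : Config E} (hζ : ζ ∈ tgtU ends l h {S : Set V | x ∈ S})
    (hpB : p ∈ cluster ends (blue ζ) l) :
    swapKeep e ζ ∈ tgtU ends l h {S : Set V | x ∈ S} ∧ p ∈ cluster ends (blue (swapKeep e ζ)) l := by
  rw [hleaf.mem_tgt_leaf_iff hxl] at hζ ⊢
  obtain ⟨hh, he, hpR⟩ := hζ
  have hlx : l ≠ x := hxl.symm
  have hpx : p ≠ x := fun h' => hleaf.up h'.symm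
  have hag : ∀ e', e' ≠ e → swapKeep e ζ e' = blue ζ e' := swapKeep_agree ζ
  have hag' : ∀ e', e' ≠ e → blue (swapKeep e ζ) e' = ζ e' := by
    intro e' hee
    rw [blue_swapKeep, Function.update_of_ne hee]
  refine ⟨⟨?_, swapKeep_self ζ, ?_⟩, ?_⟩
  · rintro (h1 | h1)
    · exact hh (Or.inr (hleaf.mem_cluster_of_agree_off_leaf hag hlx hxh.symm h1))
    · exact hh (Or.inl (hleaf.mem_cluster_of_agree_off_leaf hag' hlx hxh.symm h1))
  · exact hleaf.mem_cluster_of_agree_off_leaf (fun e' hee => (hag e' hee).symm) hlx hpx hpB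
  · exact hleaf.mem_cluster_of_agree_off_leaf (fun e' hee => (hag' e' hee).symm) hlx hpx hpR

include hxl in
/-- **The swap exchanges the two edge sets of `h` on the part `B`.** -/
lemma IsLeafAt.redEdges_swapKeep {ζ : Config E} (hζ : ζ ∈ tgtU ends l h {S : Set V | x ∈ S})
    (hpB : p ∈ cluster ends (blue ζ) l) :
    redEdges ends (swapKeep e ζ) h = blueEdges ends ζ h ∧
      blueEdges ends (swapKeep e ζ) h = redEdges ends ζ h := by
  rw [hleaf.mem_tgt_leaf_iff hxl] at hζ
  obtain ⟨hh, he, hpR⟩ := hζ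
  have hlx : l ≠ x := hxl.symm
  have hpx : p ≠ x := fun h' => hleaf.up h'.symm
  have hag : ∀ e', e' ≠ e → blue ζ e' = swapKeep e ζ e' := fun e' hee => (swapKeep_agree ζ e' hee).symm
  have hag' : ∀ e', e' ≠ e → ζ e' = blue (swapKeep e ζ) e' := by
    intro e' hee
    rw [blue_swapKeep, Function.update_of_ne hee]
  have hpBh : p ∉ cluster ends (blue ζ) h := notMem_cluster_blue_h_of_mem_cluster_blue_l hh hpB
  have hpRh : p ∉ cluster ends ζ h := notMem_cluster_h_of_mem_cluster_l hh hpR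
  constructor
  · rw [blueEdges]
    refine (hleaf.redEdges_eq_of_agree_off_leaf hxh hag hpBh ?_).symm
    intro h'
    exact hpBh (hleaf.mem_cluster_of_agree_off_leaf (fun e' hee => (hag e' hee).symm) hxh.symm hpx h')
  · rw [blueEdges]
    refine (hleaf.redEdges_eq_of_agree_off_leaf hxh hag' hpRh ?_).symm
    intro h'
    exact hpRh (hleaf.mem_cluster_of_agree_off_leaf (fun e' hee => (hag' e' hee).symm) hxh.symm hpx h')

end Counting

end LocRows

end Summit.Ventures.PercRepro2
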